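import Mathlib
import HarnessLib
import Summits.HubbardSuperconductivity.HubbardSuperconductivity.Theorems.KLProgrammeKLRegimeSplitSymInterpAliasing

/-!
# Route `KLProgramme` — GEN-6 two-leg slot (`klPredsV15`): products with harmonic samples under the symmetrised interpolant
# (part 1 of the MOMENTUM-PRODUCT DOOR for the capped (E3c) responses)

Cell `gate-hubbard-kl`, seat p1b (g7); asked for by p3 g7 (STATUS 07:13:58Z) for the (E3c)₀ VERTEX response (memo `SCALE0-TWOLEG-EXPORTS.md` v6).
Under the degree cap the two-frame response of the separated two-leg output contains MOMENTUM PRODUCTS `(K − K')(p_k⃗) · v(k⃗)` (the frame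
difference as an external-leg insertion against a lattice function `v` built from propagators and kernels); read through the symmetrised interpolant
at an off-lattice Fermi point these need a bound in which the frame difference enters by its SUP NORM `frameDist K K'` — never by the `ℓ¹` norm of its
position kernel (which scales with the cap `klFrameDeg`).  This file holds the harmonic-level facts; the door itself is `…TwoLegFrameResponseDoor`.

§1 `harmonic_mul_harmonic` — product-to-sum for the symmetrised `C₄ᵥ` harmonics (8 harmonics, weight `⅛` each);
§2 `eval_symInterp_harmonic_mul_harmonic_of_le` — inside the interpolation band the interpolant REPRODUCES a product of harmonic samples;
§3 `torusCosCoeff_mul_harmonic_latticeMomentum` — the cosine coefficients of `g · (h_{m,n}∘p)` are eighth-averages of 8 SHIFTED coefficients of `g`,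
   so `Σ_y |(g·h_{m,n}∘p)_c(y)| ≤ Σ_y |g_c(y)|` and `|(symInterp L (g·h_{m,n}∘p)).eval q| ≤ Σ_y |g_c(y)|` for ANY real lattice `g`;
§4 the coefficients of the lattice values of a frame `G`: supported in the box `|ỹᵢ| ≤ G.degree`, each `≤ max_k |G(p_k)|`, hence
   `Σ_y |(G∘p)_c(y)| ≤ (2·G.degree+1)²·max_k |G(p_k)|` — VALUE-determined (the coefficient weight `coeffNorm 0 G` is not: `κ_{1,2} = −κ_{2,1}` presents
   the zero frame).

Proofs only; nothing about the model is asserted.  References: BGM 2006 §2.4 (2.36) [cite: BenfattoGiulianiMastropietro2006].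
-/

noncomputable section

namespace Summit.HubbardSuperconductivity.HubbardSuperconductivity.Theorems.KLRegimeSplit

set_option linter.dupNamespace false -- summit = problem name (single-conjunct summit), D-0017

open Real Finset Literature.MathematicalPhysics.QuantumLattice Literature.Probability.LatticeModels
open scoped ComplexConjugate

variable (L : ℕ) [NeZero L]

/-! ## §1 Product-to-sum for the symmetrised harmonics -/

/-- **Product-to-sum**: `h_{a,b} · h_{m,n} = ⅛ [ Σ_{α ∈ {a+m,|a−m|}, β ∈ {b+n,|b−n|}} h_{α,β} + Σ_{α ∈ {a+n,|a−n|}, β ∈ {b+m,|b−m|}} h_{α,β} ]`. -/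
theorem harmonic_mul_harmonic (a b m n : ℕ) (p : Fin 2 → ℝ) :
    TrigPolyC4v.harmonic a b p * TrigPolyC4v.harmonic m n p = (1 / 8 : ℝ) * (
      (TrigPolyC4v.harmonic (a + m) (b + n) p + TrigPolyC4v.harmonic (a + m) (((b : ℤ) - n).natAbs) p +
        TrigPolyC4v.harmonic (((a : ℤ) - m).natAbs) (b + n) p +
        TrigPolyC4v.harmonic (((a : ℤ) - m).natAbs) (((b : ℤ) - n).natAbs) p) +
      (TrigPolyC4v.harmonic (a + n) (b + m) p + TrigPolyC4v.harmonic (a + n) (((b : ℤ) - m).natAbs) p +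
        TrigPolyC4v.harmonic (((a : ℤ) - n).natAbs) (b + m) p +
        TrigPolyC4v.harmonic (((a : ℤ) - n).natAbs) (((b : ℤ) - m).natAbs) p)) := by
  simp only [TrigPolyC4v.harmonic, cos_natAbs_mul]
  push_cast
  simp only [add_mul, sub_mul, Real.cos_add, Real.cos_sub]
  ring

/-! ## §2 Inside the band, the interpolant reproduces a product of harmonic samples -/

/-- **Reproduction of products in the band**: if `a + m, b + n, a + n, b + m ≤ L/2` then
`(symInterp L (h_{a,b}∘p · h_{m,n}∘p)).eval q = h_{a,b}(q)·h_{m,n}(q)`. -/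
theorem eval_symInterp_harmonic_mul_harmonic_of_le {a b m n : ℕ} (h1 : a + m ≤ L / 2) (h2 : b + n ≤ L / 2)
    (h3 : a + n ≤ L / 2) (h4 : b + m ≤ L / 2) (q : Fin 2 → ℝ) :
    (symInterp L (fun k => TrigPolyC4v.harmonic a b (latticeMomentum L k) *
        TrigPolyC4v.harmonic m n (latticeMomentum L k))).eval q =
      TrigPolyC4v.harmonic a b q * TrigPolyC4v.harmonic m n q := by
  have e : ∀ {α γ : ℕ}, α ≤ L / 2 → γ ≤ L / 2 →
      (symInterp L (fun k => TrigPolyC4v.harmonic α γ (latticeMomentum L k))).eval q = TrigPolyC4v.harmonic α γ q :=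
    fun hα hγ => eval_symInterp_harmonic_comp_latticeMomentum_of_le hα hγ q
  have d1 : ((a : ℤ) - m).natAbs ≤ L / 2 := by omega
  have d2 : ((b : ℤ) - n).natAbs ≤ L / 2 := by omega
  have d3 : ((a : ℤ) - n).natAbs ≤ L / 2 := by omega
  have d4 : ((b : ℤ) - m).natAbs ≤ L / 2 := by omega
  simp_rw [harmonic_mul_harmonic]
  rw [eval_symInterp_const_mul]
  simp only [eval_symInterp_add]
  rw [e h1 h2, e h1 d2, e d1 h2, e d1 d2, e h3 h4, e h3 d4, e d3 h4, e d3 d4]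

/-! ## §3 Multiplying by a harmonic sample shifts the cosine coefficients -/

/-- **Shift formula**: `(g · h_{m,n}∘p)_c(y) = ⅛ Σ_{i<4} (g_c(y + v_i) + g_c(y − v_i))`, `v = harmonicVecs L m n`, for ANY real lattice `g`. -/
theorem torusCosCoeff_mul_harmonic_latticeMomentum (g : TorusSite 2 L → ℝ) (m n : ℕ) (y : TorusSite 2 L) :
    torusCosCoeff L (fun k => g k * TrigPolyC4v.harmonic m n (latticeMomentum L k)) y =
      (1 / 8 : ℝ) * ∑ i : Fin 4, (torusCosCoeff L g (y + harmonicVecs L m n i) + torusCosCoeff L g (y - harmonicVecs L m n i)) := by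
  set v := harmonicVecs L m n with hv
  have hk : ∀ k : TorusSite 2 L, ((g k * TrigPolyC4v.harmonic m n (latticeMomentum L k) : ℝ) : ℂ) * torusChar k y =
      ((1 / 8 : ℝ) : ℂ) * ∑ i : Fin 4, ((g k : ℂ) * torusChar k (y + v i) + (g k : ℂ) * torusChar k (y - v i)) := by
    intro k
    rw [Complex.ofReal_mul, ofReal_harmonic_latticeMomentum, ← hv, Finset.mul_sum, Finset.mul_sum, Finset.sum_mul,
      Finset.mul_sum]
    refine Finset.sum_congr rfl fun i _ => ?_
    rw [sub_eq_add_neg, torusChar_add_right, torusChar_add_right]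
    push_cast
    ring
  simp_rw [torusCosCoeff_eq_re, hk]
  rw [← Finset.mul_sum, Finset.sum_comm, Complex.re_ofReal_mul, Complex.re_sum, ← mul_assoc,
    mul_comm (((L : ℝ) ^ 2)⁻¹), mul_assoc, Finset.mul_sum]
  congr 1
  refine Finset.sum_congr rfl fun i _ => ?_
  rw [Finset.sum_add_distrib, Complex.add_re, mul_add]

/-- **Multiplying by a harmonic sample does not increase the coefficient `ℓ¹` norm**: `Σ_y |(g·h_{m,n}∘p)_c(y)| ≤ Σ_y |g_c(y)|`. -/
theorem sum_abs_torusCosCoeff_mul_harmonic_le (g : TorusSite 2 L → ℝ) (m n : ℕ) :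
    ∑ y, |torusCosCoeff L (fun k => g k * TrigPolyC4v.harmonic m n (latticeMomentum L k)) y| ≤
      ∑ y, |torusCosCoeff L g y| := by
  have hshift : ∀ w : TorusSite 2 L, ∑ y, |torusCosCoeff L g (y + w)| = ∑ y, |torusCosCoeff L g y| := fun w =>
    Fintype.sum_equiv (Equiv.addRight w) _ _ fun _ => rfl
  have hshift' : ∀ w : TorusSite 2 L, ∑ y, |torusCosCoeff L g (y - w)| = ∑ y, |torusCosCoeff L g y| := fun w =>
    Fintype.sum_equiv (Equiv.subRight w) _ _ fun _ => rfl
  calc ∑ y, |torusCosCoeff L (fun k => g k * TrigPolyC4v.harmonic m n (latticeMomentum L k)) y|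
      = ∑ y, |(1 / 8 : ℝ) * ∑ i : Fin 4,
          (torusCosCoeff L g (y + harmonicVecs L m n i) + torusCosCoeff L g (y - harmonicVecs L m n i))| := by
        simp_rw [torusCosCoeff_mul_harmonic_latticeMomentum]
    _ ≤ ∑ y, (1 / 8 : ℝ) * ∑ i : Fin 4,
          (|torusCosCoeff L g (y + harmonicVecs L m n i)| + |torusCosCoeff L g (y - harmonicVecs L m n i)|) := by
        refine sum_le_sum fun y _ => ?_
        rw [abs_mul, abs_of_pos (by norm_num : (0 : ℝ) < 1 / 8)]
        exact mul_le_mul_of_nonneg_left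
          ((abs_sum_le_sum_abs _ _).trans (sum_le_sum fun i _ => abs_add_le _ _)) (by norm_num)
    _ = (1 / 8 : ℝ) * ∑ i : Fin 4, ((∑ y, |torusCosCoeff L g (y + harmonicVecs L m n i)|) +
          ∑ y, |torusCosCoeff L g (y - harmonicVecs L m n i)|) := by
        rw [← mul_sum, sum_comm]
        simp_rw [sum_add_distrib]
    _ = ∑ y, |torusCosCoeff L g y| := by
        simp_rw [hshift, hshift']
        rw [sum_const, card_univ, Fintype.card_fin, nsmul_eq_mul]
        push_cast
        ring

/-- Hence `|(symInterp L (g · h_{m,n}∘p)).eval q| ≤ Σ_y |g_c(y)|` at every continuum momentum, for ANY real lattice `g`. -/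
theorem abs_eval_symInterp_mul_harmonic_le (g : TorusSite 2 L → ℝ) (m n : ℕ) (q : Fin 2 → ℝ) :
    |(symInterp L (fun k => g k * TrigPolyC4v.harmonic m n (latticeMomentum L k))).eval q| ≤
      ∑ y, |torusCosCoeff L g y| :=
  (abs_symInterp_eval_le _ q).trans (sum_abs_torusCosCoeff_mul_harmonic_le L g m n)

/-! ## §4 The cosine coefficients of the lattice values of a frame: support box and value bound -/

/-- `torusCosCoeff` over a finite sum of data. -/
theorem torusCosCoeff_finset_sum {ι : Type*} (s : Finset ι) (g : ι → TorusSite 2 L → ℝ) (x : TorusSite 2 L) :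
    torusCosCoeff L (fun k => ∑ i ∈ s, g i k) x = ∑ i ∈ s, torusCosCoeff L (g i) x := by
  unfold torusCosCoeff
  simp_rw [Finset.sum_mul]
  rw [Finset.sum_comm, Finset.mul_sum]

/-- The coefficients of the lattice values of a frame, through p2's indicator formula for harmonic samples. -/
theorem torusCosCoeff_latticeValues_eq_sum (G : TrigPolyC4v) (y : TorusSite 2 L) :
    torusCosCoeff L (fun k => G.eval (latticeMomentum L k)) y =
      ∑ m ∈ range (G.degree + 1), ∑ n ∈ range (G.degree + 1), G.coeff m n *
        ((1 / 8 : ℝ) * ∑ i : Fin 4, ((if y = -(harmonicVecs L m n i) then (1 : ℝ) else 0) +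
          (if y = harmonicVecs L m n i then (1 : ℝ) else 0))) := by
  simp only [TrigPolyC4v.eval_def]
  rw [torusCosCoeff_finset_sum L (range (G.degree + 1))
    (fun m k => ∑ n ∈ range (G.degree + 1), G.coeff m n * TrigPolyC4v.harmonic m n (latticeMomentum L k))]
  refine sum_congr rfl fun m _ => ?_
  rw [torusCosCoeff_finset_sum L (range (G.degree + 1))
    (fun n k => G.coeff m n * TrigPolyC4v.harmonic m n (latticeMomentum L k))]
  refine sum_congr rfl fun n _ => ?_
  rw [torusCosCoeff_const_mul, torusCosCoeff_harmonic_comp_latticeMomentum]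

/-- The frequency vectors of `h_{m,n}` and their negatives have centred components of size `≤ max m n`. -/
theorem natAbs_valMinAbs_harmonicVecs_le (m n : ℕ) (i : Fin 4) (j : Fin 2) :
    ((harmonicVecs L m n i) j).valMinAbs.natAbs ≤ max m n ∧ ((-(harmonicVecs L m n i)) j).valMinAbs.natAbs ≤ max m n := by
  have hm : ((m : ZMod L)).valMinAbs.natAbs ≤ max m n := (foldFreq_le (L := L) m).trans (le_max_left _ _)
  have hn : ((n : ZMod L)).valMinAbs.natAbs ≤ max m n := (foldFreq_le (L := L) n).trans (le_max_right _ _)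
  have hm' : (-(m : ZMod L)).valMinAbs.natAbs ≤ max m n := by rw [ZMod.natAbs_valMinAbs_neg]; exact hm
  have hn' : (-(n : ZMod L)).valMinAbs.natAbs ≤ max m n := by rw [ZMod.natAbs_valMinAbs_neg]; exact hn
  fin_cases i <;> fin_cases j <;>
    simp only [harmonicVecs, Pi.neg_apply, neg_neg, Matrix.cons_val_zero, Matrix.cons_val_one, Matrix.cons_val,
      Fin.isValue, Fin.mk_one, Fin.zero_eta, Fin.reduceFinMk] <;>
    first | exact ⟨hm, hm'⟩ | exact ⟨hn, hn'⟩ | exact ⟨hm', hm⟩ | exact ⟨hn', hn⟩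

/-- **Support box**: the coefficients of `G∘p` vanish outside `{y : |ỹ₀|, |ỹ₁| ≤ G.degree}`. -/
theorem torusCosCoeff_latticeValues_eq_zero_of_lt (G : TrigPolyC4v) {y : TorusSite 2 L}
    (hy : G.degree < (y 0).valMinAbs.natAbs ∨ G.degree < (y 1).valMinAbs.natAbs) :
    torusCosCoeff L (fun k => G.eval (latticeMomentum L k)) y = 0 := by
  rw [torusCosCoeff_latticeValues_eq_sum]
  refine sum_eq_zero fun m hm => sum_eq_zero fun n hn => ?_
  have hmd : max m n ≤ G.degree :=
    max_le (Nat.lt_succ_iff.mp (mem_range.mp hm)) (Nat.lt_succ_iff.mp (mem_range.mp hn))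
  have hinner : ∑ i : Fin 4, ((if y = -(harmonicVecs L m n i) then (1 : ℝ) else 0) +
      (if y = harmonicVecs L m n i then (1 : ℝ) else 0)) = 0 := by
    refine sum_eq_zero fun i _ => ?_
    have h := fun j => natAbs_valMinAbs_harmonicVecs_le L m n i j
    rw [if_neg, if_neg, add_zero]
    · rintro rfl
      rcases hy with hy | hy
      · exact absurd (((h 0).1).trans hmd) (not_le.mpr hy)
      · exact absurd (((h 1).1).trans hmd) (not_le.mpr hy)
    · rintro rfl
      rcases hy with hy | hy
      · exact absurd (((h 0).2).trans hmd) (not_le.mpr hy)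
      · exact absurd (((h 1).2).trans hmd) (not_le.mpr hy)
  rw [hinner, mul_zero, mul_zero]

/-- Each cosine coefficient is at most the sup of the data: `|f_c(x)| ≤ M` if `|f k| ≤ M` for all `k`. -/
theorem abs_torusCosCoeff_le_of_forall_abs_le {f : TorusSite 2 L → ℝ} {M : ℝ} (hf : ∀ k, |f k| ≤ M) (x : TorusSite 2 L) :
    |torusCosCoeff L f x| ≤ M := by
  have hL : (0 : ℝ) < (L : ℝ) ^ 2 := by have := NeZero.ne L; positivity
  have hcard : (Fintype.card (TorusSite 2 L) : ℝ) = (L : ℝ) ^ 2 := by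
    simp [TorusSite, ZMod.card]
  unfold torusCosCoeff
  rw [abs_mul, abs_inv, abs_of_pos hL]
  calc ((L : ℝ) ^ 2)⁻¹ * |∑ k : TorusSite 2 L, f k * Real.cos (∑ i : Fin 2, latticeMomentum L k i * ((x i).valMinAbs : ℝ))|
      ≤ ((L : ℝ) ^ 2)⁻¹ * ∑ _k : TorusSite 2 L, M := by
        refine mul_le_mul_of_nonneg_left ((abs_sum_le_sum_abs _ _).trans (sum_le_sum fun k _ => ?_)) (by positivity)
        rw [abs_mul]
        have h1 : |Real.cos (∑ i : Fin 2, latticeMomentum L k i * ((x i).valMinAbs : ℝ))| ≤ 1 := Real.abs_cos_le_one _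
        have h0 : 0 ≤ |f k| := abs_nonneg _
        nlinarith [hf k]
    _ = M := by
        rw [sum_const, card_univ, nsmul_eq_mul, hcard, inv_mul_cancel_left₀ hL.ne']

/-- **The box count**: `#{y : |ỹ₀| ≤ D ∧ |ỹ₁| ≤ D} ≤ (2D+1)²`. -/
theorem card_filter_natAbs_valMinAbs_le (D : ℕ) :
    (univ.filter (fun y : TorusSite 2 L => (y 0).valMinAbs.natAbs ≤ D ∧ (y 1).valMinAbs.natAbs ≤ D)).card ≤
      (2 * D + 1) ^ 2 := by
  classical
  set B : Finset ℤ := Finset.Icc (-(D : ℤ)) D with hB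
  have hsub : univ.filter (fun y : TorusSite 2 L => (y 0).valMinAbs.natAbs ≤ D ∧ (y 1).valMinAbs.natAbs ≤ D) ⊆
      (B ×ˢ B).image (fun st : ℤ × ℤ => (![(st.1 : ZMod L), (st.2 : ZMod L)] : TorusSite 2 L)) := by
    intro y hy
    have hy' := (mem_filter.mp hy).2
    rw [mem_image]
    refine ⟨((y 0).valMinAbs, (y 1).valMinAbs), ?_, ?_⟩
    · have h0 : (((y 0).valMinAbs.natAbs : ℕ) : ℤ) ≤ D := by exact_mod_cast hy'.1
      have h1 : (((y 1).valMinAbs.natAbs : ℕ) : ℤ) ≤ D := by exact_mod_cast hy'.2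
      rw [Int.natCast_natAbs] at h0 h1
      rw [mem_product, hB, mem_Icc, mem_Icc]
      exact ⟨abs_le.mp h0, abs_le.mp h1⟩
    · funext j
      fin_cases j <;> simp [ZMod.coe_valMinAbs]
  calc (univ.filter (fun y : TorusSite 2 L => (y 0).valMinAbs.natAbs ≤ D ∧ (y 1).valMinAbs.natAbs ≤ D)).card
      ≤ ((B ×ˢ B).image (fun st : ℤ × ℤ => (![(st.1 : ZMod L), (st.2 : ZMod L)] : TorusSite 2 L))).card :=
        card_le_card hsub
    _ ≤ (B ×ˢ B).card := card_image_le
    _ = (2 * D + 1) ^ 2 := by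
        rw [card_product, hB, Int.card_Icc]
        have : ((D : ℤ) + 1 - -(D : ℤ)).toNat = 2 * D + 1 := by omega
        rw [this]
        ring

/-- **`Σ_y |(G∘p)_c(y)| ≤ (2·G.degree+1)² · max_k |G(p_k)|`** — the VALUE-determined coefficient size of the lattice values of a frame. -/
theorem sum_abs_torusCosCoeff_latticeValues_le (G : TrigPolyC4v) {M : ℝ}
    (hM : ∀ k : TorusSite 2 L, |G.eval (latticeMomentum L k)| ≤ M) :
    ∑ y, |torusCosCoeff L (fun k => G.eval (latticeMomentum L k)) y| ≤ (2 * (G.degree : ℝ) + 1) ^ 2 * M := by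
  have hM0 : 0 ≤ M := (abs_nonneg _).trans (hM 0)
  rw [← sum_filter_add_sum_filter_not univ
    (fun y : TorusSite 2 L => (y 0).valMinAbs.natAbs ≤ G.degree ∧ (y 1).valMinAbs.natAbs ≤ G.degree)]
  have hzero : ∑ y ∈ univ.filter
      (fun y : TorusSite 2 L => ¬((y 0).valMinAbs.natAbs ≤ G.degree ∧ (y 1).valMinAbs.natAbs ≤ G.degree)),
      |torusCosCoeff L (fun k => G.eval (latticeMomentum L k)) y| = 0 := by
    refine sum_eq_zero fun y hy => ?_
    have hy' := (mem_filter.mp hy).2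
    rw [torusCosCoeff_latticeValues_eq_zero_of_lt L G, abs_zero]
    rcases not_and_or.mp hy' with h | h
    · exact Or.inl (not_le.mp h)
    · exact Or.inr (not_le.mp h)
  rw [hzero, add_zero]
  calc ∑ y ∈ univ.filter
        (fun y : TorusSite 2 L => (y 0).valMinAbs.natAbs ≤ G.degree ∧ (y 1).valMinAbs.natAbs ≤ G.degree),
        |torusCosCoeff L (fun k => G.eval (latticeMomentum L k)) y|
      ≤ ∑ _y ∈ univ.filter
          (fun y : TorusSite 2 L => (y 0).valMinAbs.natAbs ≤ G.degree ∧ (y 1).valMinAbs.natAbs ≤ G.degree), M :=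
        sum_le_sum fun y _ => abs_torusCosCoeff_le_of_forall_abs_le L hM y
    _ ≤ (2 * (G.degree : ℝ) + 1) ^ 2 * M := by
        rw [sum_const, nsmul_eq_mul]
        refine mul_le_mul_of_nonneg_right ?_ hM0
        exact_mod_cast card_filter_natAbs_valMinAbs_le L G.degree

end Summit.HubbardSuperconductivity.HubbardSuperconductivity.Theorems.KLRegimeSplit

end
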